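import Literature.MathematicalPhysics.QuantumFieldTheory.Balaban1983to89.B9Ineq349MultiLevelTorus
import Literature.MathematicalPhysics.QuantumFieldTheory.Balaban1983to89.B8Ineq198MultiLevelBox

/-!
# `Balaban1983to89.B8Ineq198MultiLevelTorus` — T. Bałaban, *Spaces of regular gauge field configurations on a lattice and gauge
# fixing conditions*, Commun. Math. Phys. **99** (1985) 75–102 [Balaban1985RegularSpaces], p. 92 **(1.98), R-half «|Rf|₍₋₂₎ ≦
# B′₀|f|₍₋₂₎»** and p. 93 **(1.101) «G′ is a bounded operator from a space with the norm |·|₍₋₂₎ into a space with the norm |·|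
# for functions, and the norm |·|₍₋₁₎ for their first derivatives»** — **AT U₀ = 1 ON PRINT'S CARRIER: THE GENUINE `k`-LEVEL
# NESTED-DOMAIN TORUS FAMILY `T_η = Ω₁ ⊃ … ⊃ Ω_k` OF [B6] §2**, for the GENUINE multi-level torus `G′ = Δ′_a⁻¹ = gmlT`, `Q′`, `Q′*` and
# the projection `R = I − G′Q′*(Q′G′²Q′*)⁻¹Q′G′` of [4] (3.25), the [B6] Prop. 2.2 majorants and the inverse `(Q′G′²Q′*)⁻¹` entering BY
# THEIR PRINTED PROPERTIES

statement-level skeleton of published theorems with citation tags; proofs where landed; nothing here is a claim about the Yang–Mills mass gap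

PDF held: `paper:balaban1985-cmp99-regular-spaces-gauge-fixing` (journal page = PDF page + 74); text layer of p. 92 [PDF 18] l. 17–18 and
(1.98), p. 93 [PDF 19] (1.100)–(1.102), as re-read by this seat's lineage for the Neumann-box twin `B8Ineq198MultiLevelBox` (gen 45).  The
norms are B8 p. 86 [PDF 12] «|A|₍α₎ = sup_j sup_{Ω_j} (Lʲη)^{−α}|A|» = [4] (3.41) p. 397 («For α negative we can take Ω_j instead of
Ω_j∖Ω_{j+1}»), typed `B8ScaledSupNorm.msup`.

CITATION HEADER (lean-in-tree rule).  Cell `lit-balaban` (HOME `run/shared/lean/pub/lit-balaban/`), unit `lit-balaban-r05` gen 54 (B8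
reader/typer and fold owner; free target under protocol G.5-34(d), successor list (iii-b) of HOME/lit-balaban-r05/HANDOFF.md § gen 52/53;
the announced continuation of `B8Ineq192MultiLevelTorus` p342575 / `B9Ineq349MultiLevelTorus` p343258).  WHAT IS REPRODUCED = SKELETON
rows **B8.Claim@92** (in the WEIGHTED norm), **B8.Eq1.99** member (1.98) R-half and **B8.Eq1.101** (the G′ sentence), as
«kernel-checked proofs of a model instance» on the multi-level flat TORUS carriers of p21's `B6MultiLevelTorusOperator` /
`B6Geom246MultiLevelTorus` (`TDomains d ℓ M_h k P R`, `Ω₁ = T_η`; [B6] p. 224 «we admit the case when some domains Ω_j are equal to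
T_η»).  TWO KINDS OF ANALYTIC INPUT ENTER AS ARGUMENTS (the device of the two torus predecessors; D-0026: hypotheses of theorems, no
`… : Prop` fact minted): (a) the [B6] Prop. 2.2 majorants of `G′`, `Dd μ·G′`, `G′·(Dd μ)ᵀ`, `Lap·G′` on the torus geometry (entries 1, 2,
3, 6 of (2.67)) in the `HasMajorant` shapes of p21's `prop22_first_multiLevelTorus` (T4 p342287 ✓), `prop22_second_multiLevelTorus`
(T6 p343094 ✓, `∇_μ = dT N₀ μ`), `prop22_sixth_multiLevelTorus` (T5 p342798 ✓, `−Δ_T = perLapT N₀`) and `prop22_third_multiLevelTorus`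
(p21's `B6Prop22AdjMultiLevelTorus`, staged READY in `lit-balaban-p21/lean/`, filing) — `∇_μ` and `Δ` kept as ARBITRARY fine matrices
`Dd μ`, `Lap` here; (b) the inverse `(Q′G′²Q′*)⁻¹` as an operator `G` on `𝔅` with the printed (2.87) kernel bound.  The hypothesis-free forms of the box file's §5 (THE inverse, by `prop23_multiLevelBox`) have no torus
analogue yet (no torus Prop. 2.3 in the tree) and are NOT reproduced.  Theorems only; 0 `def`; every input BY NAME; 0 sorry.

WHAT IS PRINTED (verbatim).  p. 92 [PDF 18]: *"Let us recall that from Theorems 3.1, 3.2 of [4] it follows that |Rf| ≦ B′₀|f|, hence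
the operator R[…]R has a L^∞ norm bounded by O(α₄)B′₀²."* … *"Thus it is a function with a bounded norm |·|₍₋₂₎.  The operators R
and V are bounded in this norm, and we have |Rf|₍₋₂₎ ≦ B′₀|f|₍₋₂₎, |Vf|₍₋₂₎ ≦ O(α₄)|f|₍₋₂₎. (1.98)"*; p. 93 [PDF 19]: *"Equations
(1.95) can be changed into the equivalent equation λ = G′RD\*A + G′R𝔉₄(λ, Dλ, A, D\*A). (1.100) … One of the results of [4], Theorem
3.1, tells us that G′ is a bounded operator from a space with the norm |·|₍₋₂₎ into a space with the norm |·| for functions, and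
the norm |·|₍₋₁₎ for their first derivatives. Thus we have |G′R𝔉(λ, Dλ, A, D\*A)|, |DG′R𝔉(λ, Dλ, A, D\*A)|₍₋₁₎ ≦ O(1)B′₀ξ₁(α₀ + α₁
+ 3α₄²) on Ω_j (1.101)"*.  [4] = T. Bałaban, *Propagators for lattice gauge theories in a background field*, Commun. Math. Phys.
**99** (1985) 389–434 [Balaban1985BackgroundPropagators]: (3.41) p. 397, (3.47) p. 398 «Using Lemma 2.1 in [4] we may replace the
factor (Lʲη)^α by (Lʲη)^β(L^{j′}η)^γ with β + γ = α», (3.49) p. 399, (3.25) p. 394, and p. 399 «This way the theorems are reduced to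
the corresponding theorems for propagators without external gauge field. They were proved in [4].» ([B6] = T. Bałaban, *Propagators
and renormalization transformations for lattice gauge theories. II*, Commun. Math. Phys. **96** (1984) 223–250
[Balaban1984PropagatorsII]: p. 224 (Ω₁ = T_η admitted), Prop. 2.2 (2.67) p. 234, Prop. 2.3 (2.87) p. 238, Lemma 2.1 (2.60)–(2.61) p. 234,
(2.52)–(2.55) p. 232, (2.69) p. 235).

WHAT THIS FILE PROVES (theorems only; every input BY NAME; imports `B9Ineq349MultiLevelTorus` (⊇ `B8Ineq192MultiLevelTorus` ⊇ p21's
torus chain T1–T3) and `B8Ineq198MultiLevelBox` (for the p. 86-norm dictionary, which reads only the level map and applies verbatim at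
`D.toDomains`)).  Weights read at the point's own level `j = D.lev x`: «|f|₍₋ₙ₎ ≦ S» ⟺ `|f(z)| ≦ S·(L^{j(z)})⁻ⁿ` for all points `z`.
* §1 ENGINE on the torus (twins of the box file's §1): `hasMajorant_of_kernelBoundT` (a (3.49)-shaped kernel bound ⇒ block majorant
  `Be^{−ρd_T}`), `apply_le_of_invPowT` (a block majorant applied to a `(Lʲ)⁻ⁿ`-weighted input under (2.60)/(2.61) on `geomTB`/`geomT`),
  `rowSum_and_thresholdT` (Lemma 2.1 on the torus `lemma21_torus` at a given rate + the (2.60) threshold, «RM sufficiently large» explicit).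
* §2 **`ineq198R_multiLevelTorus`** — for every exponent `n`: under the FIRST Prop.-2.2 majorant hypothesis and for EVERY `G` with the
  (2.87)-bound, `|(Pf)(x)| ≦ B′₀(L^{j(x)})⁻ⁿS` and **`|(Rf)(x)| ≦ B′₀(L^{j(x)})⁻ⁿS`** whenever `|f(z)| ≦ S(L^{j(z)})⁻ⁿ` (`R = rProjMLT = 1 −
  pProjMLT`); `n = 2` is the printed (1.98) R-half.  Mechanism = B8 p. 92 / [4] p. 399: the (3.49)₀ kernel bound of `P` on the torus
  (`ineq349_multiLevelTorus`, entry 1; its `∇`-hypothesis fed the zero family) ⇒ block majorant ⇒ «using again Lemma 2.1».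
* §3 **`ineq1101_multiLevelTorus`** — for every `n`, under the FOUR Prop.-2.2 majorant hypotheses (entries 1, 2, 3, 6; no `G`):
  `|(G′f)(x)| ≦ C′(Lʲ)²(Lʲ)⁻ⁿS`, `|(Dd μ·G′f)(x)| ≦ C′Lʲ(Lʲ)⁻ⁿS`, `|(G′(Dd μ)ᵀf)(x)| ≦ C′Lʲ(Lʲ)⁻ⁿS`, `|(Lap·G′f)(x)| ≦ C′(Lʲ)⁻ⁿS`;
  **`ineq1101_multiLevelTorus_two`** — `n = 2` = THE PRINTED SENTENCE OF (1.101) (+ `G′∇*`, + the Δ-entry).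
* §4 **`ineq1101_GR_multiLevelTorus`** — the composite letter `G′R` of (1.100)–(1.101): `|(G′Rf)(x)| ≦ C″S`, `|(Dd μ·G′Rf)(x)| ≦ C″(Lʲ)⁻¹S`
  for `|f(z)| ≦ S(L^{j(z)})⁻²`.
* §5 IN PRINT'S OWN NORM `|·|₍α₎` of p. 86 = `B8ScaledSupNorm.msup (ℓ+1) k 1 α (Ω_j := {z : j ≤ lev z})`: **`ineq198R_multiLevelTorus_msup`**
  (`|Rf|₍₋ₙ₎ ≦ B′₀|f|₍₋ₙ₎`, `|Pf|₍₋ₙ₎ ≦ B′₀|f|₍₋ₙ₎`) and **`ineq1101_multiLevelTorus_msup`** (`|G′f|₍₀₎, |Dd μ·G′f|₍₋₁₎, |G′(Dd μ)ᵀf|₍₋₁₎,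
  |Lap·G′f|₍₋₂₎ ≦ C′|f|₍₋₂₎`) — the printed shapes of (1.98) and (1.101) symbol for symbol, under the same hypotheses.
With this file EVERY [4]-input of B8 Sects. D–E built from the SCALAR letters `G′`, `(Q′G′²Q′*)⁻¹`, `H′`, `R` ((1.92) + Δ-entry, «Q′H′ =
I», «|Rf| ≦ B′₀|f|», (1.98) R-half, (1.101), (3.49)) is a theorem at U₀ = 1 ON PRINT'S CARRIER `T_η` modulo the named Prop.-2.2/2.3
inputs of p21's torus chain (HOME/lit-balaban-r05/B8-CLOSURE.md §2 (h), §3.1(a)).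

HONEST SCOPE / NOT CLAIMED.  (i) As the two torus predecessors: levels `1 … k` with `Ω₁ = T_η`, background `U₀ = 1` (`A = 0`), scalar
fibre, lattice units `η = 1` at the finest level, `m² = 0`, `x ∈ Ω_j` read at the point's own level; the Prop.-2.2 majorants and
`(Q′G′²Q′*)⁻¹` are ARGUMENTS (conditional on inhabitants: entries 1/2/6 in the tree by p21 (T4/T6/T5), entry 3 READY, torus Prop. 2.3 not
begun — hence no `M_h ≥ 3`, «M large», `P_μ ≥ 4` or weight-window hypothesis here); constants EXISTENTIAL (functions of `d, ℓ, C, δ₀, C₁, δ₁, n`),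
thresholds «RM sufficiently large» explicit and `n`-dependent.  (ii) The general statements at a regular background `U₀ ∈ 𝔄_k` ([4]
Thms 3.1–3.3) stay the typed leaves / function-level theorems of `B8Ineq198R`, `B8Ineq192Op`, `B9Ineq347AllEntries`; rows B8.Claim@92 /
B8.Eq1.99 / B8.Eq1.101 heads are NOT changed by this instance (owner's standing word).  (iii) The (1.98) V-half is `B8Ineq197.ineq198_local`;
the abstract normed spaces of `B8SectDSource` are not instantiated here.  NOT summit progress, NOT continuum, NOT Clay.

RELATED IN THE TREE, NOT DUPLICATED (stem check 2026-08-22T23:06Z: `ls Balaban1983to89 | grep -i '198\|1101'` = `B8Ineq198R` (function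
level), `B8Ineq198MultiLevelBox` (the Neumann-box twin, whose p. 86-norm dictionary is used BY NAME), `B5Ineq1101QGQTorus`,
`B15Ineq198ConcreteC`, `B16Eq1101Subtraction`, `B16Exp198*` (other papers); no multi-level torus instance): `B8Ineq192MultiLevelTorus.*`,
`B9Ineq349MultiLevelTorus.*`, `B6Geom246MultiLevelTorus.*`, `B6MultiLevelTorusOperator.*` (USED BY NAME), `B8SectDSource.*` (the consumer of
the two hypotheses; not modified), `B8ScaledSupNorm.*` (the p. 86 norm; not modified).
-/

namespace Literature.MathematicalPhysics.QuantumFieldTheory.Balaban1983to89.B8Ineq198MultiLevelTorus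

open Finset Matrix
open B4Reflection242 (boxDom)
open B6MultiLevelBoxOperator
open B6MultiLevelTorusOperator
open B6Geom246MultiLevelBox
open B6Geom246MultiLevelTorus
open B6Ineq268MultiLevelBox
open B6RandomWalk (HasMajorant BlockSupp hasMajorant_mono)
open B6Ineq261LevelGap (K261 K261_nonneg theta_lt_one_of_log)
open B6Expansion282 (kerOp)
open B6Prop23Chain (mat)
open B8Ineq192MultiLevelBox (abs_apply_le_of_levelBound levelRowSum_le ineq261With_of_le)
open B8Ineq192MultiLevelTorus
open B9Ineq349MultiLevelTorus (pProjMLT rProjMLT_eq_one_sub_pProjMLT ineq349_multiLevelTorus)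

noncomputable section

variable {d : ℕ}

/-! ## §1  Engine: block majorant from a (3.49)-shaped kernel bound; a majorant applied to a `(Lʲ)⁻ⁿ`-weighted input -/

section Engine

variable {ℓ Mh k R : ℕ} {P : Fin (d + 1) → ℕ} {D : TDomains d ℓ Mh k P R}

/-- a linear map on functions of a finite set, applied: the sum over the unit columns. [folklore] -/
private theorem apply_eq_sum_single {ι Y : Type} [Fintype ι] [DecidableEq ι] (Φ : (ι → ℝ) →ₗ[ℝ] (Y → ℝ)) (X : ι → ℝ)
    (x : Y) : Φ X x = ∑ y' : ι, Φ (Pi.single y' 1) x * X y' := by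
  have hdec : X = ∑ y' : ι, X y' • (Pi.single y' (1 : ℝ) : ι → ℝ) := by
    funext z
    rw [Finset.sum_apply]
    simp [Pi.single_apply]
  conv_lhs => rw [hdec, map_sum, Finset.sum_apply]
  refine Finset.sum_congr rfl fun y' _ => ?_
  rw [map_smul, Pi.smul_apply, smul_eq_mul, mul_comm]

/-- **BLOCK MAJORANT FROM A (3.49)-SHAPED KERNEL BOUND** ((2.51)/(2.55) «|(Tλ)(x)| ≦ K(y, y′)|λ|, supp λ ⊂ B^{j′}(y′)» from a
pointwise kernel estimate): if the matrix entries of a fine-lattice operator satisfy `|T(x, x′)| ≦ B·W(y(x′))⁻¹·e^{−ρd(y(x),y(x′))}`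
(`W(y′) = (L^{j′})^{d+1}`, the number of fine points of the block `B(y′)` being `≦ W(y′)`), then `T` has the block majorant
`K(y, y′) = B·e^{−ρd(y,y′)}` — summing the kernel over the block cancels the printed `(L^{j′}η)^{−d}`.
[cite: Balaban1985BackgroundPropagators, (3.49) p.399, p.391 (kernels); Balaban1984PropagatorsII, (2.51) p.232, (2.55) p.232, (2.69) p.235] -/
theorem hasMajorant_of_kernelBoundT {T : Module.End ℝ (↥(boxDom (N0 ℓ Mh k P)) → ℝ)} {B ρ : ℝ} (hB : 0 ≤ B)
    (hker : ∀ x x' : ↥(boxDom (N0 ℓ Mh k P)), |T (Pi.single x' 1) x| ≤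
      B * (W D.toDomains (blkOf D.toDomains x'))⁻¹ * Real.exp (-(ρ * (geomT D).dist (blkOf D.toDomains x) (blkOf D.toDomains x')))) :
    HasMajorant (g := geomT D) (blkOf D.toDomains) T (fun y y' => B * Real.exp (-(ρ * (geomT D).dist y y'))) := by
  intro y' u c hu x
  have hW := W_pos D.toDomains y'
  have hc : 0 ≤ c := hu.nonneg
  set Kc : ℝ := B * (W D.toDomains y')⁻¹ * Real.exp (-(ρ * (geomT D).dist (blkOf D.toDomains x) y')) * c with hKc
  have hKc0 : 0 ≤ Kc := by rw [hKc]; positivity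
  have hterm : ∀ x' : ↥(boxDom (N0 ℓ Mh k P)), |T (Pi.single x' 1) x * u x'| ≤
      Kc * (if blkOf D.toDomains x' = y' then (1 : ℝ) else 0) := by
    intro x'
    by_cases h : blkOf D.toDomains x' = y'
    · rw [if_pos h, mul_one, abs_mul, hKc]
      have h1 := hker x x'
      rw [h] at h1
      exact mul_le_mul h1 (hu.bound x' h) (abs_nonneg _) (by positivity)
    · rw [if_neg h, mul_zero, hu.off x' h, mul_zero, abs_zero]
  have hcard := card_blkOf_le D.toDomains y'
  rw [apply_eq_sum_single T u x]
  calc |∑ x' : ↥(boxDom (N0 ℓ Mh k P)), T (Pi.single x' 1) x * u x'|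
      ≤ ∑ x' : ↥(boxDom (N0 ℓ Mh k P)), |T (Pi.single x' 1) x * u x'| := Finset.abs_sum_le_sum_abs _ _
    _ ≤ ∑ x' : ↥(boxDom (N0 ℓ Mh k P)), Kc * (if blkOf D.toDomains x' = y' then (1 : ℝ) else 0) :=
        Finset.sum_le_sum fun x' _ => hterm x'
    _ = Kc * (((Finset.univ.filter fun x : ↥(boxDom (N0 ℓ Mh k P)) => blkOf D.toDomains x = y').card : ℕ) : ℝ) := by
        rw [← Finset.mul_sum, Finset.sum_boole]
    _ ≤ Kc * W D.toDomains y' := mul_le_mul_of_nonneg_left hcard hKc0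
    _ = B * Real.exp (-(ρ * (geomT D).dist (blkOf D.toDomains x) y')) * c := by
        rw [hKc]; field_simp

/-- **A BLOCK MAJORANT APPLIED TO A `(Lʲ)⁻ⁿ`-WEIGHTED INPUT** ([4] p. 398: «Using Lemma 2.1 in [4] we may replace the factor (Lʲη)^α by
(Lʲη)^β(L^{j′}η)^γ with β + γ = α»; B8 p. 92 «The operators R and V are bounded in this norm»): if `T` has the majorant
`C·p(y)·e^{−σd(y,y′)}` (`C, p ≥ 0`), the input satisfies `|u(z)| ≦ A·(L^{j(z)})⁻ⁿ`, the row sums at the rate `τ` are `≦ c`,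
`τ + β ≦ σ`, `β ≥ 0` and `Lⁿ ≦ e^{β(RM−1)}` ((2.60) threshold), then `|(Tu)(x)| ≦ A·C·p(y(x))·(Lⁿc)·(L^{j(x)})⁻ⁿ`.
[cite: Balaban1985BackgroundPropagators, (3.47) p.398, (3.41) p.397; Balaban1985RegularSpaces, (1.98) p.92; Balaban1984PropagatorsII, Lemma 2.1 (2.60)–(2.61) p.234, (2.52)–(2.55) p.232] -/
theorem apply_le_of_invPowT (hMh : 1 ≤ Mh) (hP : ∀ μ, 1 ≤ P μ) (hRM : 1 ≤ R * ((ℓ + 1) * Mh))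
    {T : Module.End ℝ (↥(boxDom (N0 ℓ Mh k P)) → ℝ)} {C σ β τ c : ℝ} (hC : 0 ≤ C) (hβ : 0 ≤ β) (hτβ : τ + β ≤ σ)
    {p : ↥(bset D.toDomains) → ℝ} (hp : ∀ y, 0 ≤ p y)
    (hT : HasMajorant (g := geomT D) (blkOf D.toDomains) T (fun y y' => C * p y * Real.exp (-(σ * (geomT D).dist y y'))))
    (h261 : ∀ y : (geomT D).Site, ∑ y'' : (geomT D).Site, Real.exp (-(τ * (geomT D).dist y y'')) ≤ c)
    (n : ℕ) (hthr : ((ℓ : ℝ) + 1) ^ n ≤ Real.exp (β * ((geomTB D).R * (geomTB D).M)))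
    {u : ↥(boxDom (N0 ℓ Mh k P)) → ℝ} {A : ℝ} (hA : 0 ≤ A)
    (hu : ∀ z, |u z| ≤ A * ((geomT D).len (blkOf D.toDomains z) ^ n)⁻¹) (x : ↥(boxDom (N0 ℓ Mh k P))) :
    |T u x| ≤ A * C * p (blkOf D.toDomains x) * (((ℓ : ℝ) + 1) ^ n * c) * ((geomT D).len (blkOf D.toDomains x) ^ n)⁻¹ := by
  have hdnn := (triangle_refl_nonneg_T D hMh hP).2.2
  have hlen0 : ∀ y : ↥(bset D.toDomains), 0 ≤ (geomT D).len y := fun y => (lenT_pos D y).le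
  have h1 := abs_apply_le_of_levelBound (g := geomT D) (blkOf D.toDomains) hT (p := fun b => ((geomT D).len b ^ n)⁻¹) hA
    (fun b => inv_nonneg.2 (pow_nonneg (hlen0 b) n)) hu x
  have hf : ∀ y y'' : (geomT D).Site, ((geomT D).len y'' ^ n)⁻¹ ≤
      ((ℓ : ℝ) + 1) ^ n * Real.exp (β * (geomT D).dist y y'') * ((geomT D).len y ^ n)⁻¹ :=
    fun y y'' => inv_pow_lenT_le hMh hP hRM n hβ hthr y y''
  have h2 := levelRowSum_le (g := geomT D) hdnn (σ := σ) (β := β) (τ := τ) (A := ((ℓ : ℝ) + 1) ^ n) (c := c)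
    hτβ (by positivity) (f := fun b => ((geomT D).len b ^ n)⁻¹) (fun b => inv_nonneg.2 (pow_nonneg (hlen0 b) n))
    hf h261 (blkOf D.toDomains x)
  refine h1.trans ?_
  have hsum : ∑ b' : (geomT D).Site, C * p (blkOf D.toDomains x) * Real.exp (-(σ * (geomT D).dist (blkOf D.toDomains x) b')) *
        ((geomT D).len b' ^ n)⁻¹ = C * p (blkOf D.toDomains x) * ∑ b' : (geomT D).Site,
          Real.exp (-(σ * (geomT D).dist (blkOf D.toDomains x) b')) * ((geomT D).len b' ^ n)⁻¹ := by
    rw [Finset.mul_sum]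
    exact Finset.sum_congr rfl fun b' _ => by ring
  rw [hsum]
  have hCp : 0 ≤ C * p (blkOf D.toDomains x) := mul_nonneg hC (hp _)
  calc A * (C * p (blkOf D.toDomains x) * ∑ b' : (geomT D).Site,
          Real.exp (-(σ * (geomT D).dist (blkOf D.toDomains x) b')) * ((geomT D).len b' ^ n)⁻¹)
      ≤ A * (C * p (blkOf D.toDomains x) * (((ℓ : ℝ) + 1) ^ n * c * ((geomT D).len (blkOf D.toDomains x) ^ n)⁻¹)) :=
        mul_le_mul_of_nonneg_left (mul_le_mul_of_nonneg_left h2 hCp) hA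
    _ = A * C * p (blkOf D.toDomains x) * (((ℓ : ℝ) + 1) ^ n * c) * ((geomT D).len (blkOf D.toDomains x) ^ n)⁻¹ := by ring

/-- the `n`-dependent (2.59)-type threshold: for `N₁ = ⌈(2(d+1) + n + 1)·L/σ⌉ + 1` one has `(2(d+1) + n + 1)·L < σN₁`. [folklore] -/
private theorem threshold_gt {σ : ℝ} (hσ : 0 < σ) (d ℓ n : ℕ) {N₁ : ℕ}
    (hN₁ : N₁ = ⌈(2 * ((d : ℝ) + 1) + n + 1) * ((ℓ : ℝ) + 1) / σ⌉₊ + 1) :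
    (2 * ((d : ℝ) + 1) + n + 1) * ((ℓ : ℝ) + 1) < σ * (N₁ : ℝ) := by
  have h : (2 * ((d : ℝ) + 1) + n + 1) * ((ℓ : ℝ) + 1) / σ < (N₁ : ℝ) := by
    rw [hN₁]; push_cast
    exact lt_of_le_of_lt (Nat.le_ceil _) (by linarith)
  rw [div_lt_iff₀ hσ] at h
  linarith

/-- **LEMMA 2.1 AND THE SCALE ABSORPTION ON THE TORUS AT A GIVEN RATE** (the two uses of «RM sufficiently large» behind «using
again Lemma 2.1», made explicit): for `σ > 0` and `N₁ = ⌈(2(d+1) + n + 1)L/σ⌉ + 1`, if `R·L·M_h ≥ N₁ + 1` then the row sums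
`Σ_{y′}e^{−τd(y,y′)}` are `≦ K261(N₁, d+1, L, 1, σ)` for every `τ ≥ σ` ((2.61)) and `Lⁿ ≦ e^{σ(RM−1)}` ((2.60) threshold).
[cite: Balaban1984PropagatorsII, Lemma 2.1 (2.59)–(2.61) pp.233–234, (2.2) p.224] -/
theorem rowSum_and_thresholdT (hMh : 1 ≤ Mh) (hP : ∀ μ, 1 ≤ P μ) {σ : ℝ} (hσ : 0 < σ) (n : ℕ) {N₁ : ℕ}
    (hN₁ : N₁ = ⌈(2 * ((d : ℝ) + 1) + n + 1) * ((ℓ : ℝ) + 1) / σ⌉₊ + 1) (hRM : N₁ + 1 ≤ R * ((ℓ + 1) * Mh)) :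
    (∀ τ : ℝ, σ ≤ τ → ∀ y : (geomT D).Site,
        ∑ y'' : (geomT D).Site, Real.exp (-(τ * (geomT D).dist y y'')) ≤ K261 N₁ (d + 1) ((ℓ : ℝ) + 1) 1 (1 * σ)) ∧
      ((ℓ : ℝ) + 1) ^ n ≤ Real.exp (σ * ((geomTB D).R * (geomTB D).M)) := by
  have hL0 : (0 : ℝ) < (ℓ : ℝ) + 1 := by positivity
  have hL1 : (1 : ℝ) ≤ (ℓ : ℝ) + 1 := by linarith [(Nat.cast_nonneg ℓ : (0 : ℝ) ≤ ℓ)]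
  have hlog : Real.log ((ℓ : ℝ) + 1) ≤ (ℓ : ℝ) + 1 := (Real.log_le_sub_one_of_pos hL0).trans (by linarith)
  have hlog0 : 0 ≤ Real.log ((ℓ : ℝ) + 1) := Real.log_nonneg hL1
  have hN₁pos : 0 < N₁ := by rw [hN₁]; omega
  have hgt := threshold_gt hσ d ℓ n hN₁
  have hdnn := (triangle_refl_nonneg_T D hMh hP).2.2
  have hd0 : (0 : ℝ) ≤ (d : ℝ) := Nat.cast_nonneg d
  have hn0 : (0 : ℝ) ≤ (n : ℝ) := Nat.cast_nonneg n
  refine ⟨?_, ?_⟩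
  · -- (2.61) at the rate `σ` via `lemma21_torus` (α = 1, δ₀ := σ), then monotonicity in the rate
    have hθ : Real.exp (-(1 * σ)) * ((ℓ : ℝ) + 1) ^ ((2 * (d + 1 : ℕ) : ℝ) / N₁) < 1 := by
      refine theta_lt_one_of_log hL0 hN₁pos ?_
      push_cast
      nlinarith [mul_le_mul_of_nonneg_left hlog (by positivity : (0 : ℝ) ≤ 2 * ((d : ℝ) + 1))]
    obtain ⟨-, h261, -, -⟩ := lemma21_torus D hMh hP hN₁pos hRM hσ.le (α := 1) zero_le_one le_rfl hθ
    intro τ hτ y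
    have h := ineq261With_of_le (g := geomT D) h261 (δ' := τ) (α' := 1) (by linarith) hdnn y
    simpa only [one_mul] using h
  · -- `n·log L ≤ n·L ≤ σN₁ ≤ σ(R·L·M_h − 1)`
    rw [geomTB_RM D hMh]
    have hge : (N₁ : ℝ) ≤ (R : ℝ) * (((ℓ : ℝ) + 1) * Mh) - 1 := by
      have : ((N₁ + 1 : ℕ) : ℝ) ≤ ((R * ((ℓ + 1) * Mh) : ℕ) : ℝ) := by exact_mod_cast hRM
      push_cast at this; linarith
    have hnl : (n : ℝ) * Real.log ((ℓ : ℝ) + 1) ≤ σ * ((R : ℝ) * (((ℓ : ℝ) + 1) * Mh) - 1) := by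
      have h1 : σ * (N₁ : ℝ) ≤ σ * ((R : ℝ) * (((ℓ : ℝ) + 1) * Mh) - 1) := mul_le_mul_of_nonneg_left hge hσ.le
      nlinarith [mul_le_mul_of_nonneg_left hlog hn0]
    calc ((ℓ : ℝ) + 1) ^ n = Real.exp ((n : ℝ) * Real.log ((ℓ : ℝ) + 1)) := by
          rw [← Real.exp_log (pow_pos hL0 n), Real.log_pow]
      _ ≤ _ := Real.exp_le_exp.2 hnl

end Engine

/-! ## §2  (1.98), R-half, at U₀ = 1 on the `k`-level torus family: «|Rf|₍₋ₙ₎ ≦ B′₀|f|₍₋ₙ₎», `G` standing for `(Q′G′²Q′*)⁻¹` -/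

section R198

/-- **(1.98), R-HALF, AT U₀ = 1 ON THE `k`-LEVEL TORUS FAMILY, THE FIRST PROP.-2.2 MAJORANT AND THE INVERSE ENTERING AS ARGUMENTS**
(«The operators R and V are bounded in this norm, and we have |Rf|₍₋₂₎ ≦ B′₀|f|₍₋₂₎», here for every natural exponent `n`): for every
`n` and all `C, δ₀, C₁, δ₁ > 0` there are `B′₀ > 0`, `N₁ ≥ 1` (functions of `d, ℓ, C, δ₀, C₁, δ₁, n`) such that for every number of
levels `k`, every `M_h ≥ 1`, every `R` with `R·L·M_h ≥ N₁ + 1`, every torus size `P`, every nested torus family `D` of block-union domains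
with (2.1)–(2.2) (`Ω₁ = T_η`), every weight sequence `a`, IF `G′ = gmlT` has the first-entry majorant `C·L^{2j}e^{−½δ₀d_T}` ([B6] Prop. 2.2,
p21's `prop22_first_multiLevelTorus`), THEN for EVERY operator `G` on `𝔅` with `|G(y, y′)| ≦ C₁(Lʲ)⁻⁴(L^{j′})^{−(d+1)}e^{−½δ₁d_T(y,y′)}`
(the printed bound (2.87) of [B6] Prop. 2.3 for `(Q′G′²Q′*)⁻¹`, (2.69) convention), every fine function `f` with `|f(z)| ≦ S·(L^{j(z)})⁻ⁿ`
(`j(z) = D.lev z`, i.e. `|f|₍₋ₙ₎ ≦ S`) and every point `x` of the torus: `|(Pf)(x)| ≦ B′₀(L^{j(x)})⁻ⁿS` and **`|(Rf)(x)| ≦ B′₀(L^{j(x)})⁻ⁿS`**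
for `P = G′Q′*GQ′G′` (`pProjMLT`) and `R = 1 − P` (`rProjMLT`, [4] (3.25) = B8 (1.27) at the flat background).  Mechanism (p. 92 «from
Theorems 3.1, 3.2 of [4]» / [4] p. 399 «using again Lemma 2.1»): the (3.49)₀ kernel bound of `P` on the torus
(`B9Ineq349MultiLevelTorus.ineq349_multiLevelTorus`, entry 1 — its `∇`-hypothesis fed the zero family) ⇒ block majorant `Be^{−ρd_T}`
(§1) ⇒ the weight `(L^{j′})⁻ⁿ` moved to `x` by (2.60) and the row summed by (2.61) (§1 `apply_le_of_invPowT`, `lemma21_torus`).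
[cite: Balaban1985RegularSpaces, (1.98) p.92, p.92 l.17–18, (1.27) p.80; Balaban1985BackgroundPropagators, (3.49) p.399, (3.47) p.398, (3.41) p.397, (3.25) p.394; Balaban1984PropagatorsII, Prop. 2.2 (2.67) p.234, Prop. 2.3 (2.87) p.238, Lemma 2.1 (2.60)–(2.61) p.234, p.224 (Ω₁ = T_η admitted)] -/
theorem ineq198R_multiLevelTorus (d ℓ : ℕ) {C δ₀ C₁ δ₁ : ℝ} (hC : 0 < C) (hδ₀ : 0 < δ₀) (hC₁ : 0 < C₁) (hδ₁ : 0 < δ₁) (n : ℕ) :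
    ∃ B₀' : ℝ, ∃ N₁ : ℕ, 0 < B₀' ∧ 0 < N₁ ∧
      ∀ (k Mh R : ℕ), 1 ≤ Mh → N₁ + 1 ≤ R * ((ℓ + 1) * Mh) →
      ∀ (P : Fin (d + 1) → ℕ) (_hP : ∀ μ, 1 ≤ P μ) (D : TDomains d ℓ Mh k P R) (a : ℕ → ℝ),
        HasMajorant (g := geomT D) (blkOf D.toDomains) (Matrix.toLin' (gmlT (N0 ℓ Mh k P) ℓ k D.lev a))
          (fun y y' => C * ((ℓ : ℝ) + 1) ^ (2 * y.1.1) * Real.exp (-(δ₀ / 2 * (geomT D).dist y y'))) →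
        ∀ G : Module.End ℝ (↥(bset D.toDomains) → ℝ),
          (∀ y y' : ↥(bset D.toDomains), |mat G y y' / W D.toDomains y'| ≤
            C₁ * (geomT D).len y ^ (-(4 : ℝ)) * (geomT D).len y' ^ (-((d + 1 : ℕ) : ℝ)) *
              Real.exp (-(δ₁ / 2 * (geomT D).dist y y'))) →
          ∀ (f : ↥(boxDom (N0 ℓ Mh k P)) → ℝ) (S : ℝ), 0 ≤ S →
            (∀ z : ↥(boxDom (N0 ℓ Mh k P)), |f z| ≤ S * ((((ℓ : ℝ) + 1) ^ D.lev z.1) ^ n)⁻¹) →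
            ∀ x : ↥(boxDom (N0 ℓ Mh k P)),
              |pProjMLT D a G f x| ≤ B₀' * ((((ℓ : ℝ) + 1) ^ D.lev x.1) ^ n)⁻¹ * S ∧
              |rProjMLT D a G f x| ≤ B₀' * ((((ℓ : ℝ) + 1) ^ D.lev x.1) ^ n)⁻¹ * S := by
  obtain ⟨ρ, B, N₀, hρ, hB, hN₀, h349⟩ := ineq349_multiLevelTorus d ℓ hC hδ₀ hC₁ hδ₁
  have hL0 : (0 : ℝ) < (ℓ : ℝ) + 1 := by positivity
  -- Lemma 2.1 / absorption at the rate `ρ/2`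
  obtain ⟨σ, hσ⟩ : ∃ σ : ℝ, σ = ρ / 2 := ⟨_, rfl⟩
  have hσ0 : 0 < σ := by rw [hσ]; positivity
  obtain ⟨N₁, hN₁⟩ : ∃ N₁ : ℕ, N₁ = ⌈(2 * ((d : ℝ) + 1) + n + 1) * ((ℓ : ℝ) + 1) / σ⌉₊ + 1 := ⟨_, rfl⟩
  obtain ⟨cK, hcK⟩ : ∃ cK : ℝ, cK = K261 N₁ (d + 1) ((ℓ : ℝ) + 1) 1 (1 * σ) := ⟨_, rfl⟩
  have hcK0 : 0 ≤ cK := by rw [hcK]; exact K261_nonneg hL0.le zero_le_one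
  obtain ⟨Bp, hBp⟩ : ∃ Bp : ℝ, Bp = B * (((ℓ : ℝ) + 1) ^ n * cK) := ⟨_, rfl⟩
  have hBp0 : 0 ≤ Bp := by rw [hBp]; positivity
  refine ⟨Bp + 1, max N₀ N₁, by linarith, lt_of_lt_of_le hN₀ (le_max_left _ _), ?_⟩
  intro k Mh R hMh1 hRM P hP D a hTG G hG f S hS hf x
  have hRM0 : N₀ + 1 ≤ R * ((ℓ + 1) * Mh) := le_trans (Nat.succ_le_succ (le_max_left _ _)) hRM
  have hRM1 : N₁ + 1 ≤ R * ((ℓ + 1) * Mh) := le_trans (Nat.succ_le_succ (le_max_right _ _)) hRM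
  have hRMone : 1 ≤ R * ((ℓ + 1) * Mh) := le_trans (by omega) hRM1
  obtain ⟨hrow, hthr⟩ := rowSum_and_thresholdT (D := D) hMh1 hP hσ0 n hN₁ hRM1
  rw [← hcK] at hrow
  -- the `∇`-hypothesis of (3.49) is not needed for entry 1: feed the zero family
  have hKD : ∀ y y' : ↥(bset D.toDomains), 0 ≤ C * ((ℓ : ℝ) + 1) ^ y.1.1 * Real.exp (-(δ₀ / 2 * (geomT D).dist y y')) :=
    fun y y' => mul_nonneg (mul_nonneg hC.le (pow_nonneg hL0.le _)) (Real.exp_nonneg _)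
  -- the block majorant of `P` from the (3.49)₀ kernel bound
  have hker : ∀ x x' : ↥(boxDom (N0 ℓ Mh k P)), |pProjMLT D a G (Pi.single x' 1) x| ≤
      B * (W D.toDomains (blkOf D.toDomains x'))⁻¹ *
        Real.exp (-(ρ * (geomT D).dist (blkOf D.toDomains x) (blkOf D.toDomains x'))) :=
    fun x x' => (h349 k Mh R hMh1 hRM0 P hP D a (fun _ => 0) hTG
      (fun _ => hasMajorant_zero_mul D _ hKD) G hG x x').1
  have hmaj : HasMajorant (g := geomT D) (blkOf D.toDomains) (pProjMLT D a G)
      (fun y y' => B * (1 : ℝ) * Real.exp (-(ρ * (geomT D).dist y y'))) := by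
    refine hasMajorant_mono (g := geomT D) (blkOf D.toDomains) (hasMajorant_of_kernelBoundT hB.le hker)
      fun y y' => le_of_eq ?_
    rw [mul_one]
  -- the input in the engine's letters
  have hu : ∀ z : ↥(boxDom (N0 ℓ Mh k P)), |f z| ≤ S * ((geomT D).len (blkOf D.toDomains z) ^ n)⁻¹ := fun z => by
    rw [lenT_blkOf]; exact hf z
  have hPf := apply_le_of_invPowT (D := D) hMh1 hP hRMone (σ := ρ) (β := σ) (τ := σ) (c := cK) hB.le hσ0.le
    (by rw [hσ]; linarith) (p := fun _ => (1 : ℝ)) (fun _ => zero_le_one) hmaj (hrow σ le_rfl) n hthr hS hu x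
  rw [lenT_blkOf, mul_one] at hPf
  -- `|Pf(x)| ≤ Bp·λ⁻ⁿ·S`
  have hlam : 0 < (((ℓ : ℝ) + 1) ^ D.lev x.1) ^ n := pow_pos (pow_pos hL0 _) _
  have hPf' : |pProjMLT D a G f x| ≤ Bp * ((((ℓ : ℝ) + 1) ^ D.lev x.1) ^ n)⁻¹ * S := by
    refine hPf.trans (le_of_eq ?_)
    rw [hBp]; ring
  have hw0 : 0 ≤ ((((ℓ : ℝ) + 1) ^ D.lev x.1) ^ n)⁻¹ * S := mul_nonneg (inv_nonneg.2 hlam.le) hS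
  refine ⟨?_, ?_⟩
  · calc |pProjMLT D a G f x| ≤ Bp * ((((ℓ : ℝ) + 1) ^ D.lev x.1) ^ n)⁻¹ * S := hPf'
      _ ≤ (Bp + 1) * ((((ℓ : ℝ) + 1) ^ D.lev x.1) ^ n)⁻¹ * S := by
          rw [mul_assoc, mul_assoc]; exact mul_le_mul_of_nonneg_right (by linarith) hw0
  · -- `Rf = f − Pf`
    have e : rProjMLT D a G f x = f x - pProjMLT D a G f x := by
      rw [rProjMLT_eq_one_sub_pProjMLT, LinearMap.sub_apply, Module.End.one_apply, Pi.sub_apply]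
    rw [e]
    calc |f x - pProjMLT D a G f x| ≤ |f x| + |pProjMLT D a G f x| := abs_sub _ _
      _ ≤ S * ((((ℓ : ℝ) + 1) ^ D.lev x.1) ^ n)⁻¹ + Bp * ((((ℓ : ℝ) + 1) ^ D.lev x.1) ^ n)⁻¹ * S :=
          add_le_add (hf x) hPf'
      _ = (Bp + 1) * ((((ℓ : ℝ) + 1) ^ D.lev x.1) ^ n)⁻¹ * S := by ring

end R198

/-! ## §3  (1.101) / [4] (3.47) at U = 1 on the `k`-level torus family: `G′` on `(Lʲ)⁻ⁿ`-weighted inputs -/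

section G1101

/-- **[4] THEOREM 3.1 IN THE WEIGHTED NORMS (3.47) AT U = 1 ON THE `k`-LEVEL TORUS FAMILY — the four entries 1, 2, 3, 6 of (3.42) =
[B6] (2.67) for the GENUINE torus `G′ = gmlT`, applied to a `(Lʲ)⁻ⁿ`-weighted input, THE PROP.-2.2 MAJORANTS ENTERING AS ARGUMENTS**
(B8 p. 93: «G′ is a bounded operator from a space with the norm |·|₍₋₂₎ into a space with the norm |·| for functions, and the norm |·|₍₋₁₎
for their first derivatives», here for every natural exponent `n`): for every `n` and all `C, δ₀ > 0` there are `C′ > 0`, `N₁ ≥ 1`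
(functions of `d, ℓ, C, δ₀, n`) such that for every member with `R·L·M_h ≥ N₁ + 1`, every family `Dd μ` of fine matrices and every
fine matrix `Lap`, IF `G′`, `Dd μ·G′`, `G′·(Dd μ)ᵀ`, `Lap·G′` have the Prop.-2.2 majorants `C(Lʲ)^{[2,1,1,0]}e^{−½δ₀d_T}` (entries 1, 2,
3, 6 of (2.67); p21's `prop22_first/second/third/sixth_multiLevelTorus` with `Dd μ = dT N₀ μ`, `Lap = perLapT N₀ = −Δ_T`), then for
every fine function `f` with `|f(z)| ≦ S(L^{j(z)})⁻ⁿ` and every point `x` at level `j`: `|(G′f)(x)| ≦ C′(Lʲ)²(Lʲ)⁻ⁿS`,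
`|(Dd μ·G′f)(x)| ≦ C′Lʲ(Lʲ)⁻ⁿS`, `|(G′(Dd μ)ᵀf)(x)| ≦ C′Lʲ(Lʲ)⁻ⁿS`, `|(Lap·G′f)(x)| ≦ C′(Lʲ)⁻ⁿS`.  Mechanism ([4] p. 398 «Using Lemma
2.1 in [4] we may replace the factor (Lʲη)^α by (Lʲη)^β(L^{j′}η)^γ»): the block majorants applied to the weighted input by §1
`apply_le_of_invPowT` ((2.60) moves `(L^{j′})⁻ⁿ` to `x`, (2.61) = `lemma21_torus` sums the row).
[cite: Balaban1985RegularSpaces, (1.101) p.93; Balaban1985BackgroundPropagators, Theorem 3.1 (3.42) p.397, (3.47) p.398, (3.41) p.397; Balaban1984PropagatorsII, Prop. 2.2 (2.67) p.234, Lemma 2.1 (2.60)–(2.61) p.234, (2.52)–(2.55) p.232, p.224 (Ω₁ = T_η admitted)] -/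
theorem ineq1101_multiLevelTorus (d ℓ : ℕ) {C δ₀ : ℝ} (hC : 0 < C) (hδ₀ : 0 < δ₀) (n : ℕ) :
    ∃ C' : ℝ, ∃ N₁ : ℕ, 0 < C' ∧ 0 < N₁ ∧
      ∀ (k Mh R : ℕ), 1 ≤ Mh → N₁ + 1 ≤ R * ((ℓ + 1) * Mh) →
      ∀ (P : Fin (d + 1) → ℕ) (_hP : ∀ μ, 1 ≤ P μ) (D : TDomains d ℓ Mh k P R) (a : ℕ → ℝ)
        (Dd : Fin (d + 1) → Matrix ↥(boxDom (N0 ℓ Mh k P)) ↥(boxDom (N0 ℓ Mh k P)) ℝ)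
        (Lap : Matrix ↥(boxDom (N0 ℓ Mh k P)) ↥(boxDom (N0 ℓ Mh k P)) ℝ),
        HasMajorant (g := geomT D) (blkOf D.toDomains) (Matrix.toLin' (gmlT (N0 ℓ Mh k P) ℓ k D.lev a))
          (fun y y' => C * ((ℓ : ℝ) + 1) ^ (2 * y.1.1) * Real.exp (-(δ₀ / 2 * (geomT D).dist y y'))) →
        (∀ μ : Fin (d + 1), HasMajorant (g := geomT D) (blkOf D.toDomains)
          (Matrix.toLin' (Dd μ * gmlT (N0 ℓ Mh k P) ℓ k D.lev a))
          (fun y y' => C * ((ℓ : ℝ) + 1) ^ y.1.1 * Real.exp (-(δ₀ / 2 * (geomT D).dist y y')))) →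
        (∀ μ : Fin (d + 1), HasMajorant (g := geomT D) (blkOf D.toDomains)
          (Matrix.toLin' (gmlT (N0 ℓ Mh k P) ℓ k D.lev a * (Dd μ)ᵀ))
          (fun y y' => C * ((ℓ : ℝ) + 1) ^ y.1.1 * Real.exp (-(δ₀ / 2 * (geomT D).dist y y')))) →
        HasMajorant (g := geomT D) (blkOf D.toDomains)
          (Matrix.toLin' (Lap * gmlT (N0 ℓ Mh k P) ℓ k D.lev a))
          (fun y y' => C * Real.exp (-(δ₀ / 2 * (geomT D).dist y y'))) →
        ∀ (f : ↥(boxDom (N0 ℓ Mh k P)) → ℝ) (S : ℝ), 0 ≤ S →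
          (∀ z : ↥(boxDom (N0 ℓ Mh k P)), |f z| ≤ S * ((((ℓ : ℝ) + 1) ^ D.lev z.1) ^ n)⁻¹) →
          ∀ x : ↥(boxDom (N0 ℓ Mh k P)),
            |(gmlT (N0 ℓ Mh k P) ℓ k D.lev a *ᵥ f) x| ≤
              C' * (((ℓ : ℝ) + 1) ^ D.lev x.1) ^ 2 * ((((ℓ : ℝ) + 1) ^ D.lev x.1) ^ n)⁻¹ * S ∧
            (∀ μ : Fin (d + 1), |(Dd μ *ᵥ (gmlT (N0 ℓ Mh k P) ℓ k D.lev a *ᵥ f)) x| ≤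
              C' * ((ℓ : ℝ) + 1) ^ D.lev x.1 * ((((ℓ : ℝ) + 1) ^ D.lev x.1) ^ n)⁻¹ * S) ∧
            (∀ μ : Fin (d + 1), |(gmlT (N0 ℓ Mh k P) ℓ k D.lev a *ᵥ ((Dd μ)ᵀ *ᵥ f)) x| ≤
              C' * ((ℓ : ℝ) + 1) ^ D.lev x.1 * ((((ℓ : ℝ) + 1) ^ D.lev x.1) ^ n)⁻¹ * S) ∧
            |(Lap *ᵥ (gmlT (N0 ℓ Mh k P) ℓ k D.lev a *ᵥ f)) x| ≤
              C' * ((((ℓ : ℝ) + 1) ^ D.lev x.1) ^ n)⁻¹ * S := by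
  have hL0 : (0 : ℝ) < (ℓ : ℝ) + 1 := by positivity
  -- Lemma 2.1 / absorption at the rate `δ₀/4` (majorant rate `δ₀/2 = δ₀/4 + δ₀/4`)
  obtain ⟨σ, hσ⟩ : ∃ σ : ℝ, σ = δ₀ / 4 := ⟨_, rfl⟩
  have hσ0 : 0 < σ := by rw [hσ]; positivity
  obtain ⟨N₁, hN₁⟩ : ∃ N₁ : ℕ, N₁ = ⌈(2 * ((d : ℝ) + 1) + n + 1) * ((ℓ : ℝ) + 1) / σ⌉₊ + 1 := ⟨_, rfl⟩
  have hN₁pos : 0 < N₁ := by rw [hN₁]; omega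
  obtain ⟨cK, hcK⟩ : ∃ cK : ℝ, cK = K261 N₁ (d + 1) ((ℓ : ℝ) + 1) 1 (1 * σ) := ⟨_, rfl⟩
  have hcK0 : 0 ≤ cK := by rw [hcK]; exact K261_nonneg hL0.le zero_le_one
  obtain ⟨Cp, hCp⟩ : ∃ Cp : ℝ, Cp = C * (((ℓ : ℝ) + 1) ^ n * cK) := ⟨_, rfl⟩
  have hCp0 : 0 ≤ Cp := by rw [hCp]; positivity
  refine ⟨Cp + 1, N₁, by linarith, hN₁pos, ?_⟩
  intro k Mh R hMh1 hRM1 P hP D a Dd Lap hTG hTD hTA hTL f S hS hf x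
  have hRMone : 1 ≤ R * ((ℓ + 1) * Mh) := le_trans (by omega) hRM1
  obtain ⟨hrow, hthr⟩ := rowSum_and_thresholdT (D := D) hMh1 hP hσ0 n hN₁ hRM1
  rw [← hcK] at hrow
  have hlen0 : ∀ y : ↥(bset D.toDomains), 0 ≤ (geomT D).len y := fun y => (lenT_pos D y).le
  -- the Prop.-2.2 majorants with the lengths `(geomT D).len`
  have hTG' : HasMajorant (g := geomT D) (blkOf D.toDomains) (Matrix.toLin' (gmlT (N0 ℓ Mh k P) ℓ k D.lev a))
      (fun y y' => C * (geomT D).len y ^ 2 * Real.exp (-(δ₀ / 2 * (geomT D).dist y y'))) := by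
    refine hasMajorant_mono (g := geomT D) (blkOf D.toDomains) hTG fun y y' => le_of_eq ?_
    rw [lenT_eq, ← pow_mul, Nat.mul_comm]
  have hTD' : ∀ μ : Fin (d + 1), HasMajorant (g := geomT D) (blkOf D.toDomains)
      (Matrix.toLin' (Dd μ * gmlT (N0 ℓ Mh k P) ℓ k D.lev a))
      (fun y y' => C * (geomT D).len y * Real.exp (-(δ₀ / 2 * (geomT D).dist y y'))) := by
    intro μ
    refine hasMajorant_mono (g := geomT D) (blkOf D.toDomains) (hTD μ) fun y y' => le_of_eq ?_
    rw [lenT_eq]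
  have hTA' : ∀ μ : Fin (d + 1), HasMajorant (g := geomT D) (blkOf D.toDomains)
      (Matrix.toLin' (gmlT (N0 ℓ Mh k P) ℓ k D.lev a * (Dd μ)ᵀ))
      (fun y y' => C * (geomT D).len y * Real.exp (-(δ₀ / 2 * (geomT D).dist y y'))) := by
    intro μ
    refine hasMajorant_mono (g := geomT D) (blkOf D.toDomains) (hTA μ) fun y y' => le_of_eq ?_
    rw [lenT_eq]
  have hTL' : HasMajorant (g := geomT D) (blkOf D.toDomains)
      (Matrix.toLin' (Lap * gmlT (N0 ℓ Mh k P) ℓ k D.lev a))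
      (fun y y' => C * (1 : ℝ) * Real.exp (-(δ₀ / 2 * (geomT D).dist y y'))) := by
    refine hasMajorant_mono (g := geomT D) (blkOf D.toDomains) hTL fun y y' => le_of_eq ?_
    rw [mul_one]
  -- the input in the engine's letters
  have hu : ∀ z : ↥(boxDom (N0 ℓ Mh k P)), |f z| ≤ S * ((geomT D).len (blkOf D.toDomains z) ^ n)⁻¹ := fun z => by
    rw [lenT_blkOf]; exact hf z
  have hrate : σ + σ ≤ δ₀ / 2 := by rw [hσ]; linarith
  have key : ∀ {T : Module.End ℝ (↥(boxDom (N0 ℓ Mh k P)) → ℝ)} {p : ↥(bset D.toDomains) → ℝ}, (∀ y, 0 ≤ p y) →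
      HasMajorant (g := geomT D) (blkOf D.toDomains) T
        (fun y y' => C * p y * Real.exp (-(δ₀ / 2 * (geomT D).dist y y'))) →
      |T f x| ≤ Cp * p (blkOf D.toDomains x) * ((((ℓ : ℝ) + 1) ^ D.lev x.1) ^ n)⁻¹ * S := by
    intro T p hp hT
    have h := apply_le_of_invPowT (D := D) hMh1 hP hRMone (σ := δ₀ / 2) (β := σ) (τ := σ) (c := cK) hC.le hσ0.le
      hrate hp hT (hrow σ le_rfl) n hthr hS hu x
    rw [lenT_blkOf] at h
    refine h.trans (le_of_eq ?_)
    rw [hCp]; ring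
  have hlamp : 0 < ((ℓ : ℝ) + 1) ^ D.lev x.1 := pow_pos hL0 _
  have hlam : 0 < (((ℓ : ℝ) + 1) ^ D.lev x.1) ^ n := pow_pos hlamp _
  have hw0 : 0 ≤ ((((ℓ : ℝ) + 1) ^ D.lev x.1) ^ n)⁻¹ * S := mul_nonneg (inv_nonneg.2 hlam.le) hS
  have hlx : (geomT D).len (blkOf D.toDomains x) = ((ℓ : ℝ) + 1) ^ D.lev x.1 := lenT_blkOf D x
  -- the weakening `Cp ≤ Cp + 1` against a non-negative product
  have hweak : ∀ {q : ℝ}, 0 ≤ q → ∀ {v : ℝ}, v ≤ Cp * q * ((((ℓ : ℝ) + 1) ^ D.lev x.1) ^ n)⁻¹ * S →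
      v ≤ (Cp + 1) * q * ((((ℓ : ℝ) + 1) ^ D.lev x.1) ^ n)⁻¹ * S := by
    intro q hq v hv
    refine hv.trans ?_
    have h0 : 0 ≤ q * (((((ℓ : ℝ) + 1) ^ D.lev x.1) ^ n)⁻¹ * S) := mul_nonneg hq hw0
    nlinarith
  refine ⟨?_, fun μ => ?_, fun μ => ?_, ?_⟩
  · have h := key (p := fun y => (geomT D).len y ^ 2) (fun y => pow_nonneg (hlen0 y) 2) hTG'
    rw [Matrix.toLin'_apply, hlx] at h
    exact hweak (pow_nonneg hlamp.le 2) h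
  · have h := key (p := fun y => (geomT D).len y) hlen0 (hTD' μ)
    rw [Matrix.toLin'_apply, ← Matrix.mulVec_mulVec, hlx] at h
    exact hweak hlamp.le h
  · have h := key (p := fun y => (geomT D).len y) hlen0 (hTA' μ)
    rw [Matrix.toLin'_apply, ← Matrix.mulVec_mulVec, hlx] at h
    exact hweak hlamp.le h
  · have h := key (p := fun _ => (1 : ℝ)) (fun _ => zero_le_one) hTL'
    rw [Matrix.toLin'_apply, ← Matrix.mulVec_mulVec] at h
    have h' := hweak zero_le_one h
    rw [mul_one] at h'
    exact h'

/-- **THE PRINTED SENTENCE OF (1.101), `n = 2`, ON THE TORUS**: «G′ is a bounded operator from a space with the norm |·|₍₋₂₎ into a space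
with the norm |·| for functions, and the norm |·|₍₋₁₎ for their first derivatives» — at U₀ = 1 on the `k`-level torus family, for the
GENUINE `G′ = gmlT` under the four Prop.-2.2 majorant hypotheses: if `|f(z)| ≦ S(L^{j(z)})⁻²` then `|(G′f)(x)| ≦ C′S`,
`|(Dd μ·G′f)(x)| ≦ C′(Lʲ)⁻¹S`, `|(G′(Dd μ)ᵀf)(x)| ≦ C′(Lʲ)⁻¹S`, `|(Lap·G′f)(x)| ≦ C′(Lʲ)⁻²S` (`j` the level of `x`).
[cite: Balaban1985RegularSpaces, (1.101) p.93; Balaban1985BackgroundPropagators, Theorem 3.1 (3.42) p.397, (3.47) p.398; Balaban1984PropagatorsII, Prop. 2.2 (2.67) p.234] -/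
theorem ineq1101_multiLevelTorus_two (d ℓ : ℕ) {C δ₀ : ℝ} (hC : 0 < C) (hδ₀ : 0 < δ₀) :
    ∃ C' : ℝ, ∃ N₁ : ℕ, 0 < C' ∧ 0 < N₁ ∧
      ∀ (k Mh R : ℕ), 1 ≤ Mh → N₁ + 1 ≤ R * ((ℓ + 1) * Mh) →
      ∀ (P : Fin (d + 1) → ℕ) (_hP : ∀ μ, 1 ≤ P μ) (D : TDomains d ℓ Mh k P R) (a : ℕ → ℝ)
        (Dd : Fin (d + 1) → Matrix ↥(boxDom (N0 ℓ Mh k P)) ↥(boxDom (N0 ℓ Mh k P)) ℝ)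
        (Lap : Matrix ↥(boxDom (N0 ℓ Mh k P)) ↥(boxDom (N0 ℓ Mh k P)) ℝ),
        HasMajorant (g := geomT D) (blkOf D.toDomains) (Matrix.toLin' (gmlT (N0 ℓ Mh k P) ℓ k D.lev a))
          (fun y y' => C * ((ℓ : ℝ) + 1) ^ (2 * y.1.1) * Real.exp (-(δ₀ / 2 * (geomT D).dist y y'))) →
        (∀ μ : Fin (d + 1), HasMajorant (g := geomT D) (blkOf D.toDomains)
          (Matrix.toLin' (Dd μ * gmlT (N0 ℓ Mh k P) ℓ k D.lev a))
          (fun y y' => C * ((ℓ : ℝ) + 1) ^ y.1.1 * Real.exp (-(δ₀ / 2 * (geomT D).dist y y')))) →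
        (∀ μ : Fin (d + 1), HasMajorant (g := geomT D) (blkOf D.toDomains)
          (Matrix.toLin' (gmlT (N0 ℓ Mh k P) ℓ k D.lev a * (Dd μ)ᵀ))
          (fun y y' => C * ((ℓ : ℝ) + 1) ^ y.1.1 * Real.exp (-(δ₀ / 2 * (geomT D).dist y y')))) →
        HasMajorant (g := geomT D) (blkOf D.toDomains)
          (Matrix.toLin' (Lap * gmlT (N0 ℓ Mh k P) ℓ k D.lev a))
          (fun y y' => C * Real.exp (-(δ₀ / 2 * (geomT D).dist y y'))) →
        ∀ (f : ↥(boxDom (N0 ℓ Mh k P)) → ℝ) (S : ℝ), 0 ≤ S →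
          (∀ z : ↥(boxDom (N0 ℓ Mh k P)), |f z| ≤ S * ((((ℓ : ℝ) + 1) ^ D.lev z.1) ^ 2)⁻¹) →
          ∀ x : ↥(boxDom (N0 ℓ Mh k P)),
            |(gmlT (N0 ℓ Mh k P) ℓ k D.lev a *ᵥ f) x| ≤ C' * S ∧
            (∀ μ : Fin (d + 1), |(Dd μ *ᵥ (gmlT (N0 ℓ Mh k P) ℓ k D.lev a *ᵥ f)) x| ≤
              C' * (((ℓ : ℝ) + 1) ^ D.lev x.1)⁻¹ * S) ∧
            (∀ μ : Fin (d + 1), |(gmlT (N0 ℓ Mh k P) ℓ k D.lev a *ᵥ ((Dd μ)ᵀ *ᵥ f)) x| ≤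
              C' * (((ℓ : ℝ) + 1) ^ D.lev x.1)⁻¹ * S) ∧
            |(Lap *ᵥ (gmlT (N0 ℓ Mh k P) ℓ k D.lev a *ᵥ f)) x| ≤
              C' * ((((ℓ : ℝ) + 1) ^ D.lev x.1) ^ 2)⁻¹ * S := by
  obtain ⟨C', N₁, hC', hN₁, h⟩ := ineq1101_multiLevelTorus d ℓ hC hδ₀ 2
  refine ⟨C', N₁, hC', hN₁, ?_⟩
  intro k Mh R hMh1 hRM1 P hP D a Dd Lap hTG hTD hTA hTL f S hS hf x
  obtain ⟨h1, h2, h3, h6⟩ := h k Mh R hMh1 hRM1 P hP D a Dd Lap hTG hTD hTA hTL f S hS hf x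
  have hL0 : (0 : ℝ) < (ℓ : ℝ) + 1 := by positivity
  set lam : ℝ := ((ℓ : ℝ) + 1) ^ D.lev x.1 with hlam
  have hlam0 : 0 < lam := pow_pos hL0 _
  have e1 : C' * lam ^ 2 * (lam ^ 2)⁻¹ * S = C' * S := by field_simp
  have e2 : C' * lam * (lam ^ 2)⁻¹ * S = C' * lam⁻¹ * S := by field_simp
  refine ⟨?_, fun μ => ?_, fun μ => ?_, h6⟩
  · rw [← e1]; exact h1
  · rw [← e2]; exact h2 μ
  · rw [← e2]; exact h3 μ

end G1101

/-! ## §4  The composite letter `G′R` of (1.100)–(1.101) on the torus -/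

section GR

/-- **(1.101) FOR THE COMPOSITE `G′R` OF (1.100) AT U₀ = 1 ON THE `k`-LEVEL TORUS FAMILY, THE PROP.-2.2 MAJORANTS AND THE INVERSE
ENTERING AS ARGUMENTS** («λ = G′RD\*A + G′R𝔉₄(λ, Dλ, A, D\*A). (1.100) … Thus we have |G′R𝔉(…)|, |DG′R𝔉(…)|₍₋₁₎ ≦ O(1)B′₀·(the
|·|₍₋₂₎-size of 𝔉)»): for all `C, δ₀, C₁, δ₁ > 0` there are `C″ > 0`, `N₁ ≥ 1` such that for every member with `R·L·M_h ≥ N₁ + 1`, under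
the four Prop.-2.2 majorant hypotheses, for EVERY `G` with the (2.87)-bound and every `f` with `|f(z)| ≦ S(L^{j(z)})⁻²`:
`|(G′Rf)(x)| ≦ C″S` and `|(Dd μ·G′Rf)(x)| ≦ C″(Lʲ)⁻¹S` — §2 at `n = 2` followed by §3 at `n = 2` (`C″ = C′B′₀`).
[cite: Balaban1985RegularSpaces, (1.100)–(1.101) p.93, (1.98) p.92; Balaban1985BackgroundPropagators, Theorem 3.1 (3.42) p.397, (3.47) p.398, (3.49) p.399, (3.25) p.394; Balaban1984PropagatorsII, Prop. 2.2 (2.67) p.234, Prop. 2.3 (2.87) p.238] -/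
theorem ineq1101_GR_multiLevelTorus (d ℓ : ℕ) {C δ₀ C₁ δ₁ : ℝ} (hC : 0 < C) (hδ₀ : 0 < δ₀) (hC₁ : 0 < C₁)
    (hδ₁ : 0 < δ₁) :
    ∃ C'' : ℝ, ∃ N₁ : ℕ, 0 < C'' ∧ 0 < N₁ ∧
      ∀ (k Mh R : ℕ), 1 ≤ Mh → N₁ + 1 ≤ R * ((ℓ + 1) * Mh) →
      ∀ (P : Fin (d + 1) → ℕ) (_hP : ∀ μ, 1 ≤ P μ) (D : TDomains d ℓ Mh k P R) (a : ℕ → ℝ)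
        (Dd : Fin (d + 1) → Matrix ↥(boxDom (N0 ℓ Mh k P)) ↥(boxDom (N0 ℓ Mh k P)) ℝ)
        (Lap : Matrix ↥(boxDom (N0 ℓ Mh k P)) ↥(boxDom (N0 ℓ Mh k P)) ℝ),
        HasMajorant (g := geomT D) (blkOf D.toDomains) (Matrix.toLin' (gmlT (N0 ℓ Mh k P) ℓ k D.lev a))
          (fun y y' => C * ((ℓ : ℝ) + 1) ^ (2 * y.1.1) * Real.exp (-(δ₀ / 2 * (geomT D).dist y y'))) →
        (∀ μ : Fin (d + 1), HasMajorant (g := geomT D) (blkOf D.toDomains)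
          (Matrix.toLin' (Dd μ * gmlT (N0 ℓ Mh k P) ℓ k D.lev a))
          (fun y y' => C * ((ℓ : ℝ) + 1) ^ y.1.1 * Real.exp (-(δ₀ / 2 * (geomT D).dist y y')))) →
        (∀ μ : Fin (d + 1), HasMajorant (g := geomT D) (blkOf D.toDomains)
          (Matrix.toLin' (gmlT (N0 ℓ Mh k P) ℓ k D.lev a * (Dd μ)ᵀ))
          (fun y y' => C * ((ℓ : ℝ) + 1) ^ y.1.1 * Real.exp (-(δ₀ / 2 * (geomT D).dist y y')))) →
        HasMajorant (g := geomT D) (blkOf D.toDomains)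
          (Matrix.toLin' (Lap * gmlT (N0 ℓ Mh k P) ℓ k D.lev a))
          (fun y y' => C * Real.exp (-(δ₀ / 2 * (geomT D).dist y y'))) →
        ∀ G : Module.End ℝ (↥(bset D.toDomains) → ℝ),
          (∀ y y' : ↥(bset D.toDomains), |mat G y y' / W D.toDomains y'| ≤
            C₁ * (geomT D).len y ^ (-(4 : ℝ)) * (geomT D).len y' ^ (-((d + 1 : ℕ) : ℝ)) *
              Real.exp (-(δ₁ / 2 * (geomT D).dist y y'))) →
          ∀ (f : ↥(boxDom (N0 ℓ Mh k P)) → ℝ) (S : ℝ), 0 ≤ S →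
            (∀ z : ↥(boxDom (N0 ℓ Mh k P)), |f z| ≤ S * ((((ℓ : ℝ) + 1) ^ D.lev z.1) ^ 2)⁻¹) →
            ∀ x : ↥(boxDom (N0 ℓ Mh k P)),
              |(gmlT (N0 ℓ Mh k P) ℓ k D.lev a *ᵥ rProjMLT D a G f) x| ≤ C'' * S ∧
              ∀ μ : Fin (d + 1), |(Dd μ *ᵥ (gmlT (N0 ℓ Mh k P) ℓ k D.lev a *ᵥ rProjMLT D a G f)) x| ≤
                C'' * (((ℓ : ℝ) + 1) ^ D.lev x.1)⁻¹ * S := by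
  obtain ⟨B₀', N₁, hB₀', hN₁, h198⟩ := ineq198R_multiLevelTorus d ℓ hC hδ₀ hC₁ hδ₁ 2
  obtain ⟨C', N₂, hC', hN₂, hG'⟩ := ineq1101_multiLevelTorus_two d ℓ hC hδ₀
  refine ⟨C' * B₀', max N₁ N₂, mul_pos hC' hB₀', lt_of_lt_of_le hN₁ (le_max_left _ _), ?_⟩
  intro k Mh R hMh1 hRM P hP D a Dd Lap hTG hTD hTA hTL G hG f S hS hf x
  have hRM1 : N₁ + 1 ≤ R * ((ℓ + 1) * Mh) := le_trans (Nat.succ_le_succ (le_max_left _ _)) hRM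
  have hRM2 : N₂ + 1 ≤ R * ((ℓ + 1) * Mh) := le_trans (Nat.succ_le_succ (le_max_right _ _)) hRM
  -- `|Rf|₍₋₂₎ ≤ B′₀S`
  have hRf : ∀ z : ↥(boxDom (N0 ℓ Mh k P)), |rProjMLT D a G f z| ≤
      B₀' * S * ((((ℓ : ℝ) + 1) ^ D.lev z.1) ^ 2)⁻¹ := by
    intro z
    have h := (h198 k Mh R hMh1 hRM1 P hP D a hTG G hG f S hS hf z).2
    refine h.trans (le_of_eq ?_); ring
  have hS' : 0 ≤ B₀' * S := mul_nonneg hB₀'.le hS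
  obtain ⟨h1, h2, -, -⟩ := hG' k Mh R hMh1 hRM2 P hP D a Dd Lap hTG hTD hTA hTL (rProjMLT D a G f) (B₀' * S) hS' hRf x
  refine ⟨h1.trans (le_of_eq (by ring)), fun μ => (h2 μ).trans (le_of_eq (by ring))⟩

end GR

/-! ## §5  In print's own norm `|·|₍α₎` of p. 86 (typed `B8ScaledSupNorm.msup`): (1.98) and (1.101) on the torus restated -/

section MSup

open B8ScaledSupNorm (msup msup_nonneg)
open B8Ineq198MultiLevelBox (pointwise_of_msup_le msup_le_of_pointwise_box)

/-- **(1.98), R-HALF, IN PRINT'S OWN NORM ON THE TORUS — «|Rf|₍₋ₙ₎ ≦ B′₀|f|₍₋ₙ₎» (every exponent `−n`) AT U₀ = 1 ON THE `k`-LEVEL TORUS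
FAMILY**, with `|·|₍α₎ = B8ScaledSupNorm.msup (ℓ+1) k 1 α (Ω_j = {z : j ≤ lev z})` (the dictionary `pointwise_of_msup_le` /
`msup_le_of_pointwise_box` of the box file applies verbatim: it only reads the level map), under the first Prop.-2.2 majorant hypothesis and
for every `G` with the (2.87)-bound: `|Rf|₍₋ₙ₎ ≦ B′₀|f|₍₋ₙ₎` and `|Pf|₍₋ₙ₎ ≦ B′₀|f|₍₋ₙ₎` for every fine function `f`.
[cite: Balaban1985RegularSpaces, (1.98) p.92, p.86 (definition after (1.55)), (1.27) p.80; Balaban1985BackgroundPropagators, (3.25) p.394, (3.41) p.397, (3.49) p.399; Balaban1984PropagatorsII, Prop. 2.2 (2.67) p.234, Prop. 2.3 (2.87) p.238] -/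
theorem ineq198R_multiLevelTorus_msup (d ℓ : ℕ) {C δ₀ C₁ δ₁ : ℝ} (hC : 0 < C) (hδ₀ : 0 < δ₀) (hC₁ : 0 < C₁) (hδ₁ : 0 < δ₁)
    (n : ℕ) :
    ∃ B₀' : ℝ, ∃ N₁ : ℕ, 0 < B₀' ∧ 0 < N₁ ∧
      ∀ (k Mh R : ℕ), 1 ≤ Mh → N₁ + 1 ≤ R * ((ℓ + 1) * Mh) →
      ∀ (P : Fin (d + 1) → ℕ) (_hP : ∀ μ, 1 ≤ P μ) (D : TDomains d ℓ Mh k P R) (a : ℕ → ℝ),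
        HasMajorant (g := geomT D) (blkOf D.toDomains) (Matrix.toLin' (gmlT (N0 ℓ Mh k P) ℓ k D.lev a))
          (fun y y' => C * ((ℓ : ℝ) + 1) ^ (2 * y.1.1) * Real.exp (-(δ₀ / 2 * (geomT D).dist y y'))) →
        ∀ G : Module.End ℝ (↥(bset D.toDomains) → ℝ),
          (∀ y y' : ↥(bset D.toDomains), |mat G y y' / W D.toDomains y'| ≤
            C₁ * (geomT D).len y ^ (-(4 : ℝ)) * (geomT D).len y' ^ (-((d + 1 : ℕ) : ℝ)) *
              Real.exp (-(δ₁ / 2 * (geomT D).dist y y'))) →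
          ∀ f : ↥(boxDom (N0 ℓ Mh k P)) → ℝ,
            msup (ℓ + 1) k 1 (-(n : ℝ)) (fun j (z : ↥(boxDom (N0 ℓ Mh k P))) => j ≤ D.lev z.1) (rProjMLT D a G f) ≤
              B₀' * msup (ℓ + 1) k 1 (-(n : ℝ)) (fun j (z : ↥(boxDom (N0 ℓ Mh k P))) => j ≤ D.lev z.1) f ∧
            msup (ℓ + 1) k 1 (-(n : ℝ)) (fun j (z : ↥(boxDom (N0 ℓ Mh k P))) => j ≤ D.lev z.1) (pProjMLT D a G f) ≤
              B₀' * msup (ℓ + 1) k 1 (-(n : ℝ)) (fun j (z : ↥(boxDom (N0 ℓ Mh k P))) => j ≤ D.lev z.1) f := by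
  obtain ⟨B₀', N₁, hB, hN₁, h⟩ := ineq198R_multiLevelTorus d ℓ hC hδ₀ hC₁ hδ₁ n
  refine ⟨B₀', N₁, hB, hN₁, ?_⟩
  intro k Mh R hMh1 hRM P hP D a hTG G hG f
  set S : ℝ := msup (ℓ + 1) k 1 (-(n : ℝ)) (fun j (z : ↥(boxDom (N0 ℓ Mh k P))) => j ≤ D.lev z.1) f with hSdef
  have hS : 0 ≤ S := msup_nonneg _ _ zero_le_one _ _ _
  have hf := pointwise_of_msup_le D.toDomains n (le_refl S)
  have hBS : 0 ≤ B₀' * S := mul_nonneg hB.le hS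
  have hb := h k Mh R hMh1 hRM P hP D a hTG G hG f S hS hf
  -- the dictionary speaks of `D.toDomains.lev`; the statements of `D.lev` (`TDomains.toDomains_lev`, rfl)
  refine ⟨msup_le_of_pointwise_box D.toDomains n hBS fun x => ?_, msup_le_of_pointwise_box D.toDomains n hBS fun x => ?_⟩
  · rw [TDomains.toDomains_lev]
    exact ((hb x).2).trans (le_of_eq (by ring))
  · rw [TDomains.toDomains_lev]
    exact ((hb x).1).trans (le_of_eq (by ring))

/-- **(1.101) IN PRINT'S OWN NORMS ON THE TORUS — «G′ is a bounded operator from a space with the norm |·|₍₋₂₎ into a space with the norm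
|·| for functions, and the norm |·|₍₋₁₎ for their first derivatives» AT U₀ = 1 ON THE `k`-LEVEL TORUS FAMILY** (genuine `G′ = gmlT`,
the four Prop.-2.2 majorants as hypotheses): `|G′f|₍₀₎ ≦ C′|f|₍₋₂₎`, `|Dd μ·G′f|₍₋₁₎ ≦ C′|f|₍₋₂₎`, `|G′(Dd μ)ᵀf|₍₋₁₎ ≦ C′|f|₍₋₂₎`,
`|Lap·G′f|₍₋₂₎ ≦ C′|f|₍₋₂₎` in the typed p. 86 norm.
[cite: Balaban1985RegularSpaces, (1.101) p.93, p.86 (definition after (1.55)); Balaban1985BackgroundPropagators, Theorem 3.1 (3.42) p.397, (3.47) p.398, (3.41) p.397; Balaban1984PropagatorsII, Prop. 2.2 (2.67) p.234] -/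
theorem ineq1101_multiLevelTorus_msup (d ℓ : ℕ) {C δ₀ : ℝ} (hC : 0 < C) (hδ₀ : 0 < δ₀) :
    ∃ C' : ℝ, ∃ N₁ : ℕ, 0 < C' ∧ 0 < N₁ ∧
      ∀ (k Mh R : ℕ), 1 ≤ Mh → N₁ + 1 ≤ R * ((ℓ + 1) * Mh) →
      ∀ (P : Fin (d + 1) → ℕ) (_hP : ∀ μ, 1 ≤ P μ) (D : TDomains d ℓ Mh k P R) (a : ℕ → ℝ)
        (Dd : Fin (d + 1) → Matrix ↥(boxDom (N0 ℓ Mh k P)) ↥(boxDom (N0 ℓ Mh k P)) ℝ)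
        (Lap : Matrix ↥(boxDom (N0 ℓ Mh k P)) ↥(boxDom (N0 ℓ Mh k P)) ℝ),
        HasMajorant (g := geomT D) (blkOf D.toDomains) (Matrix.toLin' (gmlT (N0 ℓ Mh k P) ℓ k D.lev a))
          (fun y y' => C * ((ℓ : ℝ) + 1) ^ (2 * y.1.1) * Real.exp (-(δ₀ / 2 * (geomT D).dist y y'))) →
        (∀ μ : Fin (d + 1), HasMajorant (g := geomT D) (blkOf D.toDomains)
          (Matrix.toLin' (Dd μ * gmlT (N0 ℓ Mh k P) ℓ k D.lev a))
          (fun y y' => C * ((ℓ : ℝ) + 1) ^ y.1.1 * Real.exp (-(δ₀ / 2 * (geomT D).dist y y')))) →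
        (∀ μ : Fin (d + 1), HasMajorant (g := geomT D) (blkOf D.toDomains)
          (Matrix.toLin' (gmlT (N0 ℓ Mh k P) ℓ k D.lev a * (Dd μ)ᵀ))
          (fun y y' => C * ((ℓ : ℝ) + 1) ^ y.1.1 * Real.exp (-(δ₀ / 2 * (geomT D).dist y y')))) →
        HasMajorant (g := geomT D) (blkOf D.toDomains)
          (Matrix.toLin' (Lap * gmlT (N0 ℓ Mh k P) ℓ k D.lev a))
          (fun y y' => C * Real.exp (-(δ₀ / 2 * (geomT D).dist y y'))) →
        ∀ f : ↥(boxDom (N0 ℓ Mh k P)) → ℝ,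
          msup (ℓ + 1) k 1 0 (fun j (z : ↥(boxDom (N0 ℓ Mh k P))) => j ≤ D.lev z.1)
              (gmlT (N0 ℓ Mh k P) ℓ k D.lev a *ᵥ f) ≤
            C' * msup (ℓ + 1) k 1 (-2) (fun j (z : ↥(boxDom (N0 ℓ Mh k P))) => j ≤ D.lev z.1) f ∧
          (∀ μ : Fin (d + 1), msup (ℓ + 1) k 1 (-1) (fun j (z : ↥(boxDom (N0 ℓ Mh k P))) => j ≤ D.lev z.1)
              (Dd μ *ᵥ (gmlT (N0 ℓ Mh k P) ℓ k D.lev a *ᵥ f)) ≤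
            C' * msup (ℓ + 1) k 1 (-2) (fun j (z : ↥(boxDom (N0 ℓ Mh k P))) => j ≤ D.lev z.1) f) ∧
          (∀ μ : Fin (d + 1), msup (ℓ + 1) k 1 (-1) (fun j (z : ↥(boxDom (N0 ℓ Mh k P))) => j ≤ D.lev z.1)
              (gmlT (N0 ℓ Mh k P) ℓ k D.lev a *ᵥ ((Dd μ)ᵀ *ᵥ f)) ≤
            C' * msup (ℓ + 1) k 1 (-2) (fun j (z : ↥(boxDom (N0 ℓ Mh k P))) => j ≤ D.lev z.1) f) ∧
          msup (ℓ + 1) k 1 (-2) (fun j (z : ↥(boxDom (N0 ℓ Mh k P))) => j ≤ D.lev z.1)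
              (Lap *ᵥ (gmlT (N0 ℓ Mh k P) ℓ k D.lev a *ᵥ f)) ≤
            C' * msup (ℓ + 1) k 1 (-2) (fun j (z : ↥(boxDom (N0 ℓ Mh k P))) => j ≤ D.lev z.1) f := by
  obtain ⟨C', N₁, hC', hN₁, h⟩ := ineq1101_multiLevelTorus_two d ℓ hC hδ₀
  refine ⟨C', N₁, hC', hN₁, ?_⟩
  intro k Mh R hMh1 hRM P hP D a Dd Lap hTG hTD hTA hTL f
  set S : ℝ := msup (ℓ + 1) k 1 (-2) (fun j (z : ↥(boxDom (N0 ℓ Mh k P))) => j ≤ D.lev z.1) f with hSdef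
  have e2 : (-2 : ℝ) = -((2 : ℕ) : ℝ) := by norm_num
  have e1 : (-1 : ℝ) = -((1 : ℕ) : ℝ) := by norm_num
  have e0 : (0 : ℝ) = -((0 : ℕ) : ℝ) := by norm_num
  have hS : 0 ≤ S := msup_nonneg _ _ zero_le_one _ _ _
  have hf : ∀ z : ↥(boxDom (N0 ℓ Mh k P)), |f z| ≤ S * ((((ℓ : ℝ) + 1) ^ D.lev z.1) ^ 2)⁻¹ := by
    have hle : msup (ℓ + 1) k 1 (-((2 : ℕ) : ℝ)) (fun j (z : ↥(boxDom (N0 ℓ Mh k P))) => j ≤ D.lev z.1) f ≤ S := by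
      rw [← e2]
    exact pointwise_of_msup_le D.toDomains 2 hle
  have hb := h k Mh R hMh1 hRM P hP D a Dd Lap hTG hTD hTA hTL f S hS hf
  have hCS : 0 ≤ C' * S := mul_nonneg hC'.le hS
  refine ⟨?_, fun μ => ?_, fun μ => ?_, ?_⟩
  · rw [e0]
    refine msup_le_of_pointwise_box D.toDomains 0 hCS fun x => ?_
    rw [pow_zero, inv_one, mul_one]
    exact (hb x).1
  · rw [e1]
    refine msup_le_of_pointwise_box D.toDomains 1 hCS fun x => ?_
    rw [pow_one, TDomains.toDomains_lev]
    exact ((hb x).2.1 μ).trans (le_of_eq (by ring))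
  · rw [e1]
    refine msup_le_of_pointwise_box D.toDomains 1 hCS fun x => ?_
    rw [pow_one, TDomains.toDomains_lev]
    exact ((hb x).2.2.1 μ).trans (le_of_eq (by ring))
  · rw [e2]
    refine msup_le_of_pointwise_box D.toDomains 2 hCS fun x => ?_
    rw [TDomains.toDomains_lev]
    exact ((hb x).2.2.2).trans (le_of_eq (by ring))

end MSup

end

end Literature.MathematicalPhysics.QuantumFieldTheory.Balaban1983to89.B8Ineq198MultiLevelTorus
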